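import Literature.NumberTheory.Automorphic.ShimuraCurveCartanLevel
import Literature.NumberTheory.Automorphic.ShimuraCurveDataExistence
import Literature.NumberTheory.Automorphic.ShimuraCurveGroupDiscrete
import Literature.NumberTheory.Automorphic.BrandtModuleChains
import HarnessLib

/-!
# TRANSPORT behind NUM, brick H0: the Eichler HULL DATUM under a Cartan datum (a fundamental domain for `ι(O₀¹)`)

Helper file `--supports stmt-BirchSwinnertonDyer-19109 --as helper` (seat `bsd-idea-10` g17, lens transfer; crux `EulerHalvesAtThree` ∕ residue crux
23422 line `cartan`, node (F2b♮) ⟺ NUM; road memo `Cruxes/EulerHalvesAtThree/TRANSPORT-HULL.md` §3.2, brick H0 of the general-`C` presentation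
independence `CartanDegreeIndep` by hull transfer). The tree's `CartanLevelCurveData.toShimuraCurveData X fd₀ h` turns a Cartan datum
`X = (B, O ⊆ O₀, ι, …)` of level `(D, M; C)` into the Eichler datum `X₀^D(M) = (B, O₀, ι, fd₀)` UNDER it, but asks for a fundamental domain `fd₀` of
the bigger group `ι(O₀¹) ⊇ ι(O¹)` as a separate input ("the fundamental domain of the bigger group is a separate input `fd₀`"); for `C = ∅` the datum's
own `fd` serves (tree `CartanDegree.isHypFundamentalDomain_fd_O₀`), for `C ≠ ∅` nothing was in the tree. THIS FILE supplies it for every `C`: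
* §1 `exists_realSplitting_apply_eq` — every `ℚ`-algebra map `ι : B → M₂(ℝ)` of a quaternion algebra `B/ℚ` IS the embedding `x ↦ E(1 ⊗ x)` of a
  real splitting `E : ℝ ⊗_ℚ B ≃ M₂(ℝ)` (the induced map `ℝ ⊗ B → M₂(ℝ)` is onto by the tree's `span_real_range_eq_top` and injective by dimension);
* §2 `isDiscreteSubgroup_normOneUnits`, `exists_isHypFundamentalDomain_normOneUnits` — hence `ι(O¹)` is discrete and has a measurable exact
  fundamental domain for EVERY order `O` and EVERY real embedding `ι` (tree `isDiscreteSubgroup_normOneUnits_of_realSplitting`,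
  `exists_isHypFundamentalDomain_of_isDiscreteSubgroup`, which were stated for embeddings of the shape `E(1 ⊗ ·)` only);
* §3 for a Cartan datum `X`: `isDiscreteSubgroup_Gamma`, `gamma_le_hullUnits` (`ι(O¹) ≤ ι(O₀¹)`), **`exists_isHypFundamentalDomain_hull`** (the input
  `fd₀` exists, so `X.toShimuraCurveData fd₀ h : ShimuraCurveData D M` is available for every `C`), and `level_pos` (`0 < M`).
HONEST FRAMING: bookkeeping (one brick of seven); nothing about NUM, crux 23422 ∕ 19109 or any summit statement is proved by this seat; BSD is
proved for no curve. [folklore]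
-/

set_option linter.dupNamespace false
set_option autoImplicit false

noncomputable section

open scoped TensorProduct

namespace Summit.BirchSwinnertonDyer.BirchSwinnertonDyer.Theorems.CartanTransport.Hull

open Literature.NumberTheory.Automorphic UpperHalfPlane

/-! ## §1 Every real embedding comes from a real splitting -/

section General

variable {B : Type*} [Ring B] [Algebra ℚ B] [IsQuaternionAlgebra ℚ B]

/-- PROVED — **`ι = E(1 ⊗ ·)` for a real splitting `E`**: a `ℚ`-algebra map `ι : B → M₂(ℝ)` of a quaternion algebra `B/ℚ` induces an
`ℝ`-algebra ISOMORPHISM `E : ℝ ⊗_ℚ B ≃ M₂(ℝ)` with `ι x = E (1 ⊗ x)` (onto: `ℝ·ι(B) = M₂(ℝ)`, tree `span_real_range_eq_top`; into: equal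
dimension `4`). [cite: VignerasLNM800, Ch. IV §1 (plongement φ : H → H ⊗ ℝ ≅ M(2,ℝ))] -/
theorem exists_realSplitting_apply_eq (ι : B →ₐ[ℚ] Matrix (Fin 2) (Fin 2) ℝ) :
    ∃ E : ℝ ⊗[ℚ] B ≃ₐ[ℝ] Matrix (Fin 2) (Fin 2) ℝ, ∀ x, ι x = E ((1 : ℝ) ⊗ₜ[ℚ] x) := by
  let f : ℝ ⊗[ℚ] B →ₐ[ℝ] Matrix (Fin 2) (Fin 2) ℝ :=
    Algebra.TensorProduct.lift (Algebra.ofId ℝ (Matrix (Fin 2) (Fin 2) ℝ)) ι (fun r b => Algebra.commutes r (ι b))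
  have hf : ∀ x, f ((1 : ℝ) ⊗ₜ[ℚ] x) = ι x := fun x => by
    change Algebra.TensorProduct.lift _ _ _ ((1 : ℝ) ⊗ₜ[ℚ] x) = _
    rw [Algebra.TensorProduct.lift_tmul, map_one, one_mul]
  have hfin : Module.finrank ℝ (ℝ ⊗[ℚ] B) = Module.finrank ℝ (Matrix (Fin 2) (Fin 2) ℝ) := by
    rw [Module.finrank_baseChange, IsQuaternionAlgebra.finrank_eq_four (K := ℚ) (D := B), Module.finrank_matrix]
    simp
  have hsurj : Function.Surjective f := by
    have h : ⊤ ≤ LinearMap.range f.toLinearMap := by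
      rw [← span_real_range_eq_top ι, Submodule.span_le]
      rintro _ ⟨x, rfl⟩
      exact ⟨(1 : ℝ) ⊗ₜ[ℚ] x, hf x⟩
    exact LinearMap.range_eq_top.mp (top_le_iff.mp h)
  have hinj : Function.Injective f :=
    (LinearMap.injective_iff_surjective_of_finrank_eq_finrank hfin (f := f.toLinearMap)).mpr hsurj
  exact ⟨AlgEquiv.ofBijective f ⟨hinj, hsurj⟩, fun x => (hf x).symm⟩

/-! ## §2 `ι(O¹)` is discrete and has a fundamental domain, for every order and every real embedding -/

/-- PROVED — **`ι(O¹)` is a discrete subgroup of `SL₂(ℝ)`** for EVERY order `O` of a quaternion algebra `B/ℚ` and EVERY `ℚ`-algebra map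
`ι : B → M₂(ℝ)` (tree `isDiscreteSubgroup_normOneUnits_of_realSplitting` + §1). [cite: VignerasLNM800, Ch. IV §1 Thm. 1.1 (1)] -/
theorem isDiscreteSubgroup_normOneUnits (ι : B →ₐ[ℚ] Matrix (Fin 2) (Fin 2) ℝ) {O : Submodule ℤ B} (hO : Brandt.IsOrder B O) :
    IsDiscreteSubgroup (normOneUnits ι hO) := by
  obtain ⟨E, hE⟩ := exists_realSplitting_apply_eq ι
  exact isDiscreteSubgroup_normOneUnits_of_realSplitting E ι hE hO

/-- PROVED — **`ι(O¹)∖ℍ` has a measurable exact fundamental domain** for every order `O` and every real embedding `ι` (tree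
`exists_isHypFundamentalDomain_of_isDiscreteSubgroup`: the lexicographic Dirichlet set). [cite: VignerasLNM800, Ch. IV §2 (surfaces de Riemann Γ̄\ℋ)] -/
theorem exists_isHypFundamentalDomain_normOneUnits (ι : B →ₐ[ℚ] Matrix (Fin 2) (Fin 2) ℝ) {O : Submodule ℤ B}
    (hO : Brandt.IsOrder B O) : ∃ F : Set ℍ, IsHypFundamentalDomain (normOneUnits ι hO) F :=
  exists_isHypFundamentalDomain_of_isDiscreteSubgroup (normOneUnits_le_range_toGL ι hO) (isDiscreteSubgroup_normOneUnits ι hO)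

end General

section Mono

variable {B : Type*} [Ring B] [Algebra ℚ B]

/-- PROVED: `ι(O¹) ≤ ι(O'¹)` for orders `O ≤ O'`. [folklore] -/
theorem normOneUnits_mono (ι : B →ₐ[ℚ] Matrix (Fin 2) (Fin 2) ℝ) {O O' : Submodule ℤ B} (hO : Brandt.IsOrder B O)
    (hO' : Brandt.IsOrder B O') (h : O ≤ O') : normOneUnits ι hO ≤ normOneUnits ι hO' := by
  rintro g ⟨⟨x, hx, hxg⟩, ⟨y, hy, hyg⟩, hg⟩
  exact ⟨⟨x, h hx, hxg⟩, ⟨y, h hy, hyg⟩, hg⟩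

end Mono

/-! ## §3 The hull datum under a Cartan datum -/

section Cartan

variable {D M : ℕ} {C : Finset ℕ} (X : CartanLevelCurveData D M C)

/-- PROVED — **`Γ = ι(O¹)` of a Cartan datum is discrete** (for `C = ∅` this is `ShimuraCurveData.isDiscreteSubgroup_Gamma`). [cite: KohenPacetti2016, §2 (the
groups Γ_ns^ε(N) ∩ Γ₀(m) are Fuchsian)] -/
theorem isDiscreteSubgroup_Gamma : IsDiscreteSubgroup X.Gamma :=
  isDiscreteSubgroup_normOneUnits X.ι X.isOrder

/-- PROVED — **the hull group `ι(O₀¹)` is discrete**. [cite: VignerasLNM800, Ch. IV §1 Thm. 1.1 (1)] -/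
theorem isDiscreteSubgroup_hullUnits : IsDiscreteSubgroup (normOneUnits X.ι X.isEichlerOrder.isOrder) :=
  isDiscreteSubgroup_normOneUnits X.ι X.isEichlerOrder.isOrder

/-- PROVED — **`Γ ≤ ι(O₀¹)`**: the Cartan curve covers the Eichler curve `X₀^D(M)` under it (`O ≤ O₀`). [folklore] -/
theorem gamma_le_hullUnits : X.Gamma ≤ normOneUnits X.ι X.isEichlerOrder.isOrder :=
  normOneUnits_mono X.ι X.isOrder X.isEichlerOrder.isOrder X.le

/-- PROVED — **THE HULL DATUM EXISTS FOR EVERY `C`**: the separate input `fd₀` of `CartanLevelCurveData.toShimuraCurveData` — a measurable exact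
fundamental domain of `ι(O₀¹)` — exists, so the Eichler datum `X.toShimuraCurveData fd₀ h : ShimuraCurveData D M` under a Cartan datum is available
(usage: `obtain ⟨fd₀, h⟩ := exists_isHypFundamentalDomain_hull X`). [folklore] -/
theorem exists_isHypFundamentalDomain_hull :
    ∃ fd₀ : Set ℍ, IsHypFundamentalDomain (normOneUnits X.ι X.isEichlerOrder.isOrder) fd₀ :=
  exists_isHypFundamentalDomain_normOneUnits X.ι X.isEichlerOrder.isOrder

end Cartan

section CartanConstants

variable {D M : ℕ} {C : Finset ℕ}

/-- PROVED — **the hull datum is non-empty as a type**: `Nonempty (ShimuraCurveData D M)` from any Cartan datum of level `(D, M; C)`. [folklore] -/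
theorem nonempty_shimuraCurveData (X : CartanLevelCurveData D M C) : Nonempty (ShimuraCurveData D M) := by
  obtain ⟨fd₀, h⟩ := exists_isHypFundamentalDomain_hull X
  exact ⟨X.toShimuraCurveData fd₀ h⟩

/-- PROVED — **`0 < M`** for a Cartan datum of level `(D, M; C)` (the Eichler order `O₀` has the finite index `M` in a maximal order). [folklore] -/
theorem level_pos (X : CartanLevelCurveData D M C) : 0 < M := by
  haveI : IsAddTorsionFree X.B := isAddTorsionFree_of_charZero_module ℚ X.B
  obtain ⟨O₁, O₂, h₁, -, -, hidx⟩ := X.isEichlerOrder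
  refine Nat.pos_of_ne_zero ?_
  rw [← hidx]
  exact relIndex_ne_zero_of_isFullLattice X.isEichlerOrder.isOrder.isFullLattice h₁.1.isFullLattice.1

/-- PROVED — **`0 < D`** (`D` is squarefree). [folklore] -/
theorem discr_pos (X : CartanLevelCurveData D M C) : 0 < D :=
  Nat.pos_of_ne_zero fun h => by simpa [h] using X.squarefree

end CartanConstants

end Summit.BirchSwinnertonDyer.BirchSwinnertonDyer.Theorems.CartanTransport.Hull
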